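import Literature.Analysis.Hypoelliptic.KohnWords
import HarnessLib

/-!
# The a priori estimate, I: weight shifting, the commutator `[P, Λ^t]` in norm, and the energy inequality at level `t`

Analysis/Hypoelliptic support file, fourteenth piece of the Fourier-side toolkit serving the
discharge of `Literature.Analysis.Distribution.Hormander1967_thm11` by Kohn's method
(M. Taylor, *Pseudodifferential Operators* (1981), Ch. XV §1, (1.17) and the passage "Finally,
we replace the `L²` norms by Sobolev norms" leading to (1.28)). Continues `KohnWords.lean`.

* real norms of symbolic sums and scalar multiples; `‖Λ^r u‖_t = ‖u‖_{t+r}`; moving weights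
  across the pairing;
* **the commutator `[P, T]` in norm**: for plain certified `T`,
  `‖[P, T] u‖_{s'} ≤ C (∑_j ‖X_j u‖_{s' + ord T} + ‖u‖_{s' + ord T})` (`HData.rn_comm_opP_le`);
* **the energy inequality at level `t`** (conjugation of (1.16) by `Λ^t`):
  `‖X_j v‖_t ≤ C (‖P v‖_t + ‖v‖_t)` (`HData.rn_Xs_le_level`).

## References

* M. E. Taylor, *Pseudodifferential Operators* (1981), Ch. XV §1.
-/

noncomputable section

open MeasureTheory Set Filter Function
open scoped ENNReal NNReal Topology ComplexConjugate InnerProductSpace BigOperators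

namespace Literature.Analysis.Hypoelliptic

variable {V : Type*} [NormedAddCommGroup V] [InnerProductSpace ℝ V] [FiniteDimensional ℝ V]
  [MeasurableSpace V] [BorelSpace V]

/-! ### Real norms: scalars, sums, Bessel weights -/

/-- `‖c u‖_t = ‖c‖ ‖u‖_t`. [folklore] -/
theorem rn_const_mul (t : ℝ) (c : ℂ) (u : V → ℂ) : rn t (fun ξ => c * u ξ) = ‖c‖ * rn t u := by
  unfold rn
  rw [wnorm_const_mul, ENNReal.toReal_mul, toReal_enorm]

/-- `‖-u‖_t = ‖u‖_t`. [folklore] -/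
theorem rn_neg (t : ℝ) (u : V → ℂ) : rn t (fun ξ => -u ξ) = rn t u := by
  unfold rn; rw [wnorm_neg]

/-- **`‖Λ^r u‖_t = ‖u‖_{t + r}`.** [folklore] -/
theorem rn_bessel (t r : ℝ) (u : V → ℂ) : rn t ((Sym.bessel r).apply u) = rn (t + r) u := by
  unfold rn
  rw [Sym.apply_bessel]
  simp only [Sym.bwC_apply]
  rw [wnorm_bw_mul]

/-- `Λ^r u ∈ Nice` for `u ∈ Nice`. [folklore] -/
theorem nice_bessel (r : ℝ) {u : V → ℂ} (hu : Nice u) : Nice ((Sym.bessel r).apply u) :=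
  (Sym.cert_bessel r).nice_apply hu

namespace Sym

/-- The real norm of a symbolic sum is at most the sum of the norms (on `Nice`). [folklore] -/
theorem rn_sum_apply_le {l : List (Sym V)} (hl : ∀ s ∈ l, Cert s) (t : ℝ) {u : V → ℂ}
    (hu : Nice u) : rn t (apply (sum l) u) ≤ (l.map fun s => rn t (apply s u)).sum := by
  induction l with
  | nil => simp [rn, wnorm]
  | cons s l ih =>
    have hl' : ∀ s' ∈ l, Cert s' := fun s' hs' => hl s' (List.mem_cons_of_mem _ hs')
    rw [sum_cons s l u hu, apply_add, List.map_cons, List.sum_cons]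
    exact (rn_add_le t ((hl s List.mem_cons_self).nice_apply hu) ((cert_sum hl').nice_apply hu)).trans
      (add_le_add le_rfl (ih hl'))

end Sym

/-! ### Moving weights across the pairing -/

/-- `⟨A, B⟩ = ⟨Λ^{-r} A, Λ^{r} B⟩`. [folklore] -/
theorem pairing_shift (r : ℝ) (A B : V → ℂ) :
    pairing A B = pairing ((Sym.bessel (-r)).apply A) ((Sym.bessel r).apply B) := by
  rw [Sym.apply_bessel, Sym.apply_bessel, pairing_mul_left]
  congr 1
  ext ξ
  simp only [Sym.bwC_apply, Complex.conj_ofReal]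
  rw [← mul_assoc, ← Complex.ofReal_mul, ← bw_add, neg_add_cancel, bw_zero]
  simp

/-- `⟨Λ^s A, Λ^s B⟩ = ⟨Λ^{s-r} A, Λ^{s+r} B⟩`. [folklore] -/
theorem pairing_bessel_shift (s r : ℝ) (A B : V → ℂ) :
    pairing ((Sym.bessel s).apply A) ((Sym.bessel s).apply B) =
      pairing ((Sym.bessel (s - r)).apply A) ((Sym.bessel (s + r)).apply B) := by
  rw [pairing_shift r ((Sym.bessel s).apply A) ((Sym.bessel s).apply B)]
  simp only [Sym.apply_bessel, Sym.bwC_apply]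
  congr 1
  · ext ξ
    rw [← mul_assoc, ← Complex.ofReal_mul, ← bw_add, show -r + s = s - r by ring]
  · ext ξ
    rw [← mul_assoc, ← Complex.ofReal_mul, ← bw_add, add_comm r s]

/-- The weighted Cauchy–Schwarz inequality: `|⟨A, B⟩| ≤ ‖A‖_{-r} ‖B‖_{r}` on `Nice`. [folklore] -/
theorem norm_pairing_le_shift (r : ℝ) {A B : V → ℂ} (hA : Nice A) (hB : Nice B) :
    ‖pairing A B‖ ≤ rn (-r) A * rn r B := by
  have h := norm_pairing_le_rn (-r) hA hB
  rwa [neg_neg] at h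

namespace HData

open Sym Field

variable (d : HData V)

/-! ### The commutator `[P, T]` in norm -/

/-- **`‖[P, T] u‖_{s'} ≤ C (∑_j ‖X_j u‖_{s'+ord T} + ‖u‖_{s'+ord T})`** for plain certified `T`.
[folklore] -/
theorem rn_comm_opP_le {T : Sym V} (hT : Cert T) (hpl : Plain T) (s' : ℝ) :
    ∃ C : ℝ, 0 ≤ C ∧ ∀ u : V → ℂ, Nice u →
      rn s' ((Sym.comm d.opP T).apply u) ≤
        C * ((∑ j, rn (s' + ord T) ((d.Xs j).apply u)) + rn (s' + ord T) u) := by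
  set τ : ℝ := ord T with hτ
  have hfcj : ∀ j, Cert (fcomm (d.X j) T) := fun j => (d.certF j).fcomm_cert (d.isField j) hT
  have hffj : ∀ j, Cert (fcomm (d.X j) (fcomm (d.X j) T)) := fun j =>
    (d.certF j).fcomm_cert (d.isField j) (hfcj j)
  choose A hA0 hA using fun j => (hfcj j).rn_le (t := s' + τ) (t' := s')
    (by have := ord_fcomm_le (d.isField j) (d.ne j) T; linarith)
  choose B hB0 hB using fun j => (hffj j).rn_le (t := s' + τ) (t' := s')
    (by have := (comm_comm_fcomm (d.isField j) (d.certF j) (d.ne j) hpl hT).2; linarith)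
  obtain ⟨A₀, hA₀0, hA₀⟩ := (d.certF0.fcomm_cert d.isField0 hT).rn_le (t := s' + τ) (t' := s')
    (by have := ord_fcomm_le d.isField0 d.ne0 T; linarith)
  obtain ⟨B₀, hB₀0, hB₀⟩ := (d.certC.ccomm_cert d.isCoefC hT).rn_le (t := s' + τ) (t' := s')
    (by have := ord_ccomm_le d.isCoefC T; linarith)
  have hS : 0 ≤ ∑ j, (2 * A j + B j) := Finset.sum_nonneg fun j _ => by
    have := hA0 j; have := hB0 j; positivity
  refine ⟨(∑ j, (2 * A j + B j)) + A₀ + B₀, by positivity, fun u hu => ?_⟩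
  rw [d.comm_opP hT hpl u hu]
  unfold commP
  have hcl : ∀ s ∈ List.ofFn (fun j : Fin d.J =>
      add (smul 2 (comp (fcomm (d.X j) T) (d.Xs j))) (fcomm (d.X j) (fcomm (d.X j) T))), Cert s := by
    intro s hs
    obtain ⟨j, rfl⟩ := List.mem_ofFn.1 hs
    exact ⟨⟨hfcj j, d.cert_Xs j⟩, hffj j⟩
  have hN1 := (cert_sum hcl).nice_apply hu
  have hN2 : Nice ((fcomm d.X0 T).apply u) := (d.certF0.fcomm_cert d.isField0 hT).nice_apply hu
  have hN3 : Nice ((ccomm d.C T).apply u) := (d.certC.ccomm_cert d.isCoefC hT).nice_apply hu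
  rw [apply_add, apply_add]
  refine (rn_add_le s' (hN1.add hN2) hN3).trans ?_
  refine (add_le_add (rn_add_le s' hN1 hN2) le_rfl).trans ?_
  have hsum := rn_sum_apply_le hcl s' hu
  rw [List.map_ofFn, List.sum_ofFn] at hsum
  -- termwise
  have hun := rn_nonneg (s' + τ) u
  have hterm : ∀ j, rn s' ((add (smul 2 (comp (fcomm (d.X j) T) (d.Xs j)))
      (fcomm (d.X j) (fcomm (d.X j) T))).apply u) ≤
      (2 * A j + B j) * (rn (s' + τ) ((d.Xs j).apply u) + rn (s' + τ) u) := by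
    intro j
    have hXu : Nice ((d.Xs j).apply u) := (d.cert_Xs j).nice_apply hu
    have hn1 : Nice ((fcomm (d.X j) T).apply ((d.Xs j).apply u)) := (hfcj j).nice_apply hXu
    have hn2 : Nice ((fcomm (d.X j) (fcomm (d.X j) T)).apply u) := (hffj j).nice_apply hu
    rw [apply_add, apply_smul, apply_comp]
    refine (rn_add_le s' (hn1.const_mul 2) hn2).trans ?_
    rw [rn_const_mul]
    have h2 : ‖(2 : ℂ)‖ = 2 := by simp
    rw [h2]
    have b1 := hA j _ hXu
    have b2 := hB j _ hu
    have hx0 := rn_nonneg (s' + τ) ((d.Xs j).apply u)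
    nlinarith only [b1, b2, hx0, hun, hA0 j, hB0 j]
  have bsum : (∑ j, rn s' ((add (smul 2 (comp (fcomm (d.X j) T) (d.Xs j)))
      (fcomm (d.X j) (fcomm (d.X j) T))).apply u)) ≤
      ∑ j, (2 * A j + B j) * ((∑ i, rn (s' + τ) ((d.Xs i).apply u)) + rn (s' + τ) u) := by
    refine Finset.sum_le_sum fun j _ => (hterm j).trans ?_
    have hsx : rn (s' + τ) ((d.Xs j).apply u) ≤ ∑ i, rn (s' + τ) ((d.Xs i).apply u) :=
      Finset.single_le_sum (f := fun i => rn (s' + τ) ((d.Xs i).apply u)) (fun _ _ => rn_nonneg _ _)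
        (Finset.mem_univ j)
    have := hA0 j; have := hB0 j
    exact mul_le_mul_of_nonneg_left (add_le_add hsx le_rfl) (by positivity)
  rw [← Finset.sum_mul] at bsum
  have b₀ := hA₀ _ hu
  have bC := hB₀ _ hu
  have hSX := Finset.sum_nonneg fun i (_ : i ∈ Finset.univ) => rn_nonneg (s' + τ) ((d.Xs i).apply u)
  simp only [Function.comp] at hsum
  nlinarith only [hsum, bsum, b₀, bC, hSX, hun, hA₀0, hB₀0, hS]

/-! ### Conjugation identities -/

/-- `X_j (Λ^t v) = Λ^t (X_j v) + [X_j, Λ^t] v` with `‖[X_j, Λ^t] v‖_{s} ≤ C ‖v‖_{s+t}`. [folklore] -/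
theorem rn_Xs_bessel_sub_le (j : Fin d.J) (t s : ℝ) :
    ∃ C : ℝ, 0 ≤ C ∧ ∀ v : V → ℂ, Nice v →
      rn s (fun ξ => (d.Xs j).apply ((bessel t).apply v) ξ - (bessel t).apply ((d.Xs j).apply v) ξ) ≤
        C * rn (s + t) v := by
  have hcf : Cert (fcomm (d.X j) (bessel t)) := (d.certF j).fcomm_cert (d.isField j) (cert_bessel t)
  obtain ⟨C, hC, h⟩ := hcf.rn_le (t := s + t) (t' := s)
    (by have := ord_fcomm_le (d.isField j) (d.ne j) (bessel t); simp only [ord_bessel] at this; linarith)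
  refine ⟨C, hC, fun v hv => ?_⟩
  have hc := comm_fcomm (d.isField j) (d.certF j) (by simp) (cert_bessel t) v hv
  rw [apply_comm] at hc
  change (fun ξ => (d.Xs j).apply ((bessel t).apply v) ξ - (bessel t).apply ((d.Xs j).apply v) ξ) = _ at hc
  rw [hc]
  exact h v hv

/-- `‖X_j (Λ^t v)‖_s` and `‖X_j v‖_{s+t}` differ by at most `C ‖v‖_{s+t}`. [folklore] -/
theorem rn_Xs_bessel_le (j : Fin d.J) (t s : ℝ) :
    ∃ C : ℝ, 0 ≤ C ∧ ∀ v : V → ℂ, Nice v →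
      rn s ((d.Xs j).apply ((bessel t).apply v)) ≤ rn (s + t) ((d.Xs j).apply v) + C * rn (s + t) v ∧
      rn (s + t) ((d.Xs j).apply v) ≤ rn s ((d.Xs j).apply ((bessel t).apply v)) + C * rn (s + t) v := by
  obtain ⟨C, hC, h⟩ := d.rn_Xs_bessel_sub_le j t s
  refine ⟨C, hC, fun v hv => ?_⟩
  have hXv : Nice ((d.Xs j).apply v) := (d.cert_Xs j).nice_apply hv
  have hA : Nice ((d.Xs j).apply ((bessel t).apply v)) := (d.cert_Xs j).nice_apply (nice_bessel t hv)
  have hB : Nice ((bessel t).apply ((d.Xs j).apply v)) := nice_bessel t hXv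
  have hD := hA.sub hB
  have hd := h v hv
  have e1 : (d.Xs j).apply ((bessel t).apply v) = fun ξ =>
      (bessel t).apply ((d.Xs j).apply v) ξ +
        ((d.Xs j).apply ((bessel t).apply v) ξ - (bessel t).apply ((d.Xs j).apply v) ξ) := by
    ext ξ; ring
  have e2 : (bessel t).apply ((d.Xs j).apply v) = fun ξ =>
      (d.Xs j).apply ((bessel t).apply v) ξ -
        ((d.Xs j).apply ((bessel t).apply v) ξ - (bessel t).apply ((d.Xs j).apply v) ξ) := by
    ext ξ; ring
  constructor
  · calc rn s ((d.Xs j).apply ((bessel t).apply v))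
        ≤ rn s ((bessel t).apply ((d.Xs j).apply v)) + rn s (fun ξ =>
            (d.Xs j).apply ((bessel t).apply v) ξ - (bessel t).apply ((d.Xs j).apply v) ξ) := by
          conv_lhs => rw [e1]
          exact rn_add_le s hB hD
      _ ≤ _ := by rw [rn_bessel]; exact add_le_add le_rfl hd
  · calc rn (s + t) ((d.Xs j).apply v) = rn s ((bessel t).apply ((d.Xs j).apply v)) := (rn_bessel s t _).symm
      _ ≤ rn s ((d.Xs j).apply ((bessel t).apply v)) + rn s (fun ξ =>
            (d.Xs j).apply ((bessel t).apply v) ξ - (bessel t).apply ((d.Xs j).apply v) ξ) := by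
          conv_lhs => rw [e2]
          exact rn_sub_le s hA hD
      _ ≤ _ := add_le_add le_rfl hd

/-- `P (Λ^t v) = Λ^t (P v) + [P, Λ^t] v` pointwise. [folklore] -/
theorem apply_opP_bessel (t : ℝ) (v : V → ℂ) :
    d.opP.apply ((bessel t).apply v) =
      fun ξ => (bessel t).apply (d.opP.apply v) ξ + (Sym.comm d.opP (bessel t)).apply v ξ := by
  ext ξ; simp only [apply_comm]; ring

/-! ### The energy inequality at level `t` -/

/-- **Energy at level `t`**: `‖X_j v‖_t ≤ C (‖P v‖_t + ‖v‖_t)` for `v ∈ Nice`, every `t`.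
[folklore] -/
theorem rn_Xs_le_level (t : ℝ) : ∃ C : ℝ, 0 ≤ C ∧ ∀ (j : Fin d.J) (v : V → ℂ), Nice v →
    rn t ((d.Xs j).apply v) ≤ C * (rn t (d.opP.apply v) + rn t v) := by
  obtain ⟨K, hK, hE⟩ := d.energy
  choose D hD0 hD using fun j => d.rn_Xs_bessel_le j t 0
  obtain ⟨CC, hCC, hC⟩ := d.rn_comm_opP_le (cert_bessel t) trivial 0
  simp only [ord_bessel, zero_add] at hC hD
  -- constants: `L = max D`, `∑ a² ≤ 8 p n + Cn²`
  set L : ℝ := ∑ j, D j with hL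
  have hL0 : 0 ≤ L := Finset.sum_nonneg fun j _ => hD0 j
  have hDL : ∀ j, D j ≤ L := fun j =>
    Finset.single_le_sum (f := D) (fun j _ => hD0 j) (Finset.mem_univ j)
  set M : ℝ := 4 + 8 * CC + 16 * CC ^ 2 * d.J + 4 * K + 4 * L ^ 2 * d.J with hM
  have hM0 : 0 ≤ M := by positivity
  refine ⟨Real.sqrt M, Real.sqrt_nonneg M, fun j v hv => ?_⟩
  set w := (bessel t).apply v with hw
  have hwN : Nice w := nice_bessel t hv
  set p := rn t (d.opP.apply v) with hp
  set n := rn t v with hn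
  have hp0 : 0 ≤ p := rn_nonneg _ _
  have hn0 : 0 ≤ n := rn_nonneg _ _
  have hw0 : rn 0 w = n := by rw [hw, rn_bessel, zero_add]
  set a : Fin d.J → ℝ := fun i => rn t ((d.Xs i).apply v) with ha
  set b : Fin d.J → ℝ := fun i => rn 0 ((d.Xs i).apply w) with hb
  have ha0 : ∀ i, 0 ≤ a i := fun i => rn_nonneg _ _
  have hb0 : ∀ i, 0 ≤ b i := fun i => rn_nonneg _ _
  have hab : ∀ i, a i ≤ b i + L * n ∧ b i ≤ a i + L * n := fun i => by
    have h := hD i v hv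
    constructor
    · exact h.2.trans (add_le_add le_rfl (mul_le_mul_of_nonneg_right (hDL i) hn0))
    · exact h.1.trans (add_le_add le_rfl (mul_le_mul_of_nonneg_right (hDL i) hn0))
  -- energy for `w`
  have hEw := hE w hwN
  rw [hw0] at hEw
  -- `⟨P w, w⟩ = ⟨Λ^t P v, w⟩ + ⟨[P,Λ^t] v, w⟩`
  have hPv : Nice (d.opP.apply v) := d.cert_opP.nice_apply hv
  have hcm : Nice ((Sym.comm d.opP (bessel t)).apply v) :=
    ((cert_comm_iff _ _).2 ⟨d.cert_opP, cert_bessel t⟩).nice_apply hv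
  have hsplit : pairing (d.opP.apply w) w =
      pairing ((bessel t).apply (d.opP.apply v)) w + pairing ((Sym.comm d.opP (bessel t)).apply v) w := by
    have h0 : InH (-0) ((bessel t).apply v) := by rw [neg_zero]; exact (nice_bessel t hv).inH 0
    rw [hw, d.apply_opP_bessel t v, pairing_add_left ((nice_bessel t hPv).inH 0) (hcm.inH 0) h0]
  have b1 : ‖pairing ((bessel t).apply (d.opP.apply v)) w‖ ≤ p * n := by
    have h := norm_pairing_le_rn 0 (nice_bessel t hPv) hwN
    rw [neg_zero, rn_bessel, zero_add, hw0] at h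
    exact h
  have b2 : ‖pairing ((Sym.comm d.opP (bessel t)).apply v) w‖ ≤ CC * ((∑ i, a i) + n) * n := by
    have h := norm_pairing_le_rn 0 hcm hwN
    rw [neg_zero, hw0] at h
    exact h.trans (mul_le_mul_of_nonneg_right (hC v hv) hn0)
  have hre : |(pairing (d.opP.apply w) w).re| ≤ p * n + CC * ((∑ i, a i) + n) * n := by
    rw [hsplit]
    exact (abs_re_le_norm _).trans ((norm_add_le _ _).trans (add_le_add b1 b2))
  -- `∑ b² ≤ 2 (p n + CC (∑a + n) n) + K n²`
  have hsumb : ∑ i, b i ^ 2 ≤ 2 * (p * n + CC * ((∑ i, a i) + n) * n) + K * n ^ 2 := by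
    have := hEw; simp only [hb]; nlinarith only [this, hre]
  -- `a_i² ≤ 2 b_i² + 2 L² n²`
  have hab2 : ∀ i, a i ^ 2 ≤ 2 * b i ^ 2 + 2 * (L * n) ^ 2 := fun i => by
    have h := (hab i).1
    nlinarith only [h, ha0 i, hb0 i, mul_nonneg hL0 hn0, sq_nonneg (b i - L * n)]
  have hsuma : ∑ i, a i ^ 2 ≤ 2 * ∑ i, b i ^ 2 + 2 * (L * n) ^ 2 * d.J := by
    calc ∑ i, a i ^ 2 ≤ ∑ i, (2 * b i ^ 2 + 2 * (L * n) ^ 2) := Finset.sum_le_sum fun i _ => hab2 i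
      _ = 2 * ∑ i, b i ^ 2 + 2 * (L * n) ^ 2 * d.J := by
          rw [Finset.sum_add_distrib, Finset.mul_sum, Finset.sum_const, Finset.card_univ,
            Fintype.card_fin, nsmul_eq_mul]; ring
  -- `4 CC (∑ a) n ≤ ½ ∑ a² + 8 CC² J n²`
  have hyoung : 4 * CC * (∑ i, a i) * n ≤ (∑ i, a i ^ 2) / 2 + 8 * CC ^ 2 * n ^ 2 * d.J := by
    have h1 : ∀ i, 4 * CC * a i * n ≤ a i ^ 2 / 2 + 8 * CC ^ 2 * n ^ 2 := fun i => by
      nlinarith only [sq_nonneg (a i - 4 * CC * n)]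
    calc 4 * CC * (∑ i, a i) * n = ∑ i, 4 * CC * a i * n := by rw [Finset.mul_sum, Finset.sum_mul]
      _ ≤ ∑ i, (a i ^ 2 / 2 + 8 * CC ^ 2 * n ^ 2) := Finset.sum_le_sum fun i _ => h1 i
      _ = (∑ i, a i ^ 2) / 2 + 8 * CC ^ 2 * n ^ 2 * d.J := by
          rw [Finset.sum_add_distrib, Finset.sum_div, Finset.sum_const, Finset.card_univ,
            Fintype.card_fin, nsmul_eq_mul]; ring
  have hsa0 : 0 ≤ ∑ i, a i := Finset.sum_nonneg fun i _ => ha0 i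
  have htot : ∑ i, a i ^ 2 ≤ M * (p + n) ^ 2 := by
    have h1 : ∑ i, a i ^ 2 ≤ 4 * (p * n) + 4 * CC * (∑ i, a i) * n +
        (4 * CC + 2 * K + 2 * L ^ 2 * d.J) * n ^ 2 := by nlinarith only [hsumb, hsuma]
    have h2 : ∑ i, a i ^ 2 ≤ 8 * (p * n) + (16 * CC ^ 2 * d.J + 8 * CC + 4 * K + 4 * L ^ 2 * d.J) * n ^ 2 := by
      nlinarith only [h1, hyoung]
    have hc0 : 0 ≤ 16 * CC ^ 2 * d.J + 8 * CC + 4 * K + 4 * L ^ 2 * d.J := by positivity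
    have h3 : 8 * (p * n) + (16 * CC ^ 2 * d.J + 8 * CC + 4 * K + 4 * L ^ 2 * d.J) * n ^ 2 ≤
        M * (p + n) ^ 2 := by
      rw [hM]
      nlinarith only [mul_nonneg hp0 hn0, sq_nonneg p, sq_nonneg n, sq_nonneg (p - n),
        mul_nonneg hc0 (sq_nonneg p), mul_nonneg hc0 (mul_nonneg hp0 hn0)]
    exact h2.trans h3
  have hj : a j ^ 2 ≤ ∑ i, a i ^ 2 :=
    Finset.single_le_sum (f := fun i => a i ^ 2) (fun _ _ => sq_nonneg _) (Finset.mem_univ j)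
  exact le_sqrt_mul_of_sq_le (ha0 j) (add_nonneg hp0 hn0) hM0 (hj.trans htot)

end HData

end Literature.Analysis.Hypoelliptic
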